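import Summits.AtomisticToContinuum.BoseEinsteinCondensation.Theses.BECInfraredBound

/-!
# `BecDepletionSplit` (stmt-AtomisticToContinuum-9026): window count + UV tail ⇒ inner-box depletion

Route `BECInfraredBound` of `AtomisticToContinuum/BoseEinsteinCondensation`, mode-counting glue piece 2/3.
For every repulsive finite-range `v`:
(window count — for all `ε ∈ (0,1/4)`, `K > 0`, `η > 0`, at small density, eventually in `N`, every
`δ`-near-minimiser `Ψ` has `Σ'_{k ≠ 0, ‖k‖ ≤ K√ρ·L} ⟨φ'_k, γ_Ψ φ'_k⟩ ≤ ηN`)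
→ (ultraviolet tail — some `K > 0`, `θ < 1` with the same clause ending in
`Σ'_{K√ρ·L < ‖k‖} ⟨φ'_k, γ_Ψ φ'_k⟩ ≤ θN`)
→ (depletion — some `θ' < 1` with the same clause ending in `Σ'_{k ≠ 0} ⟨φ'_k, γ_Ψ φ'_k⟩ ≤ θ'N`).
Here `φ'_k` are the plane waves of the inner box `Λ' = (εL, L−εL)³` and all sums are unconditional
`ℝ≥0∞`-valued `tsum`s over subtypes of the lattice `Fin 3 → ℤ`.

Proof (line `Sketch` of the crux chain; the three lemmas are verbatim the registered stubs of
`Cruxes/BecDepletionSplit/Lines/birth.lean`, and the composition is its kernel-checked `BecDepletionSplit_of`):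
* `becDepletionSplit_latticeTsumSplit`: `Σ'_{k≠0} f ≤ Σ'_{k≠0, ‖k‖≤R} f + Σ'_{R<‖k‖} f` for every
  `f : ℤ³ → ℝ≥0∞` and real `R` (`{k ≠ 0} ⊆ window ∪ tail`, `ENNReal.tsum_mono_subtype`, `ENNReal.tsum_union_le`);
* `becDepletionSplit_thresholdCombine`: for `θ < 1`, with `θ⁺ = max θ 0`, `η = (1−θ⁺)/2`, `θ' = (1+θ⁺)/2 < 1`,
  `a ≤ ofReal (ηN) → b ≤ ofReal (θN) → a + b ≤ ofReal (θ'N)` (the clip handles the corner `θ ≤ 0`);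
* `becDepletionSplit_nearMinCombine`: two "small density / eventually in `N` / some `δ` / every
  `δ`-near-minimiser" clauses combine along a pointwise implication (`min` of the `ρ₀`'s,
  `Filter.Eventually` intersection, `min` of the `δ`'s).
Then take `K, θ` from the tail hypothesis, `η, θ'` from the threshold lemma, the window count at `(ε, K, η)`,
the tail at `ε`, and combine. References: LSSY2005 Ch. 11 (11.26)–(11.27); DysonLiebSimon1978 §1.
-/

noncomputable section

open Filter
open scoped ENNReal NNReal BigOperators

namespace Summit.AtomisticToContinuum.BoseEinsteinCondensation.Theorems

open Literature.MathematicalPhysics.QuantumManyBody.BoseGas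

/-- **Lattice tsum split** (registered stub `stub_latticeTsumSplit`, verbatim): for every
`f : ℤ³ → ℝ≥0∞` and every real `R`, `Σ'_{k≠0} f ≤ Σ'_{k≠0, ‖k‖≤R} f + Σ'_{R<‖k‖} f`
(`‖·‖` the sup norm of `ℝ³`). Proof: `{k ≠ 0} ⊆ {k ≠ 0 ∧ ‖k‖ ≤ R} ∪ {R < ‖k‖}` by `le_or_gt`, then
monotonicity of `ℝ≥0∞`-tsums in the index set and subadditivity over a union. [folklore] -/
theorem becDepletionSplit_latticeTsumSplit :
    ∀ (f : (Fin 3 → ℤ) → ENNReal) (R : ℝ),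
      ∑' k : {k : Fin 3 → ℤ // k ≠ 0}, f k.1 ≤
        (∑' k : {k : Fin 3 → ℤ // k ≠ 0 ∧ ‖(fun j => (k j : ℝ))‖ ≤ R}, f k.1) +
          ∑' k : {k : Fin 3 → ℤ // R < ‖(fun j => (k j : ℝ))‖}, f k.1 := by
  intro f R
  have hsub : ({k : Fin 3 → ℤ | k ≠ 0} : Set (Fin 3 → ℤ)) ⊆
      {k | k ≠ 0 ∧ ‖(fun j => (k j : ℝ))‖ ≤ R} ∪ {k | R < ‖(fun j => (k j : ℝ))‖} := by
    intro k hk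
    rcases le_or_gt ‖(fun j => (k j : ℝ))‖ R with h | h
    · exact Or.inl ⟨hk, h⟩
    · exact Or.inr h
  exact (ENNReal.tsum_mono_subtype f hsub).trans (ENNReal.tsum_union_le f _ _)

/-- **Threshold combine** (registered stub `stub_thresholdCombine`, verbatim): for `θ < 1` there are
`η > 0` and `θ' < 1` with `a ≤ ofReal (ηN) → b ≤ ofReal (θN) → a + b ≤ ofReal (θ'N)` for all `N, a, b`.
Witnesses `η = (1 - θ⁺)/2`, `θ' = (1 + θ⁺)/2`, `θ⁺ = max θ 0` (the clip covers the corner `θ ≤ 0`,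
where `ofReal (θN) = 0`). [folklore] -/
theorem becDepletionSplit_thresholdCombine :
    ∀ θ : ℝ, θ < 1 → ∃ η : ℝ, 0 < η ∧ ∃ θ' : ℝ, θ' < 1 ∧ ∀ (N : ℕ) (a b : ENNReal),
      a ≤ ENNReal.ofReal (η * N) → b ≤ ENNReal.ofReal (θ * N) → a + b ≤ ENNReal.ofReal (θ' * N) := by
  intro θ hθ
  have h0 : 0 ≤ max θ 0 := le_max_right _ _
  have h1 : max θ 0 < 1 := max_lt hθ one_pos
  refine ⟨(1 - max θ 0) / 2, by linarith, (1 + max θ 0) / 2, by linarith, ?_⟩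
  intro N a b ha hb
  have hN : (0 : ℝ) ≤ N := Nat.cast_nonneg N
  have hb' : b ≤ ENNReal.ofReal (max θ 0 * N) :=
    hb.trans (ENNReal.ofReal_le_ofReal (mul_le_mul_of_nonneg_right (le_max_left _ _) hN))
  calc a + b ≤ ENNReal.ofReal ((1 - max θ 0) / 2 * N) + ENNReal.ofReal (max θ 0 * N) :=
        add_le_add ha hb'
    _ = ENNReal.ofReal ((1 - max θ 0) / 2 * N + max θ 0 * N) :=
        (ENNReal.ofReal_add (mul_nonneg (by linarith) hN) (mul_nonneg h0 hN)).symm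
    _ = ENNReal.ofReal ((1 + max θ 0) / 2 * N) := by
        congr 1
        ring

/-- **Near-minimiser clause combinator** (registered stub `stub_nearMinCombine`, verbatim): for a fixed
`v` and predicates `P Q R ρ N Ψ` with `P → Q → R` pointwise, the clauses
`∃ ρ₀ > 0, ∀ ρ ∈ (0,ρ₀), ∀ᶠ N, ∃ δ > 0, ∀ Ψ, energy v Ψ ≤ E₀ + δ → P ρ N Ψ` and the same for `Q` give the
same for `R`: `ρ₀ := min`, `Filter.Eventually` intersection, `δ := min δ₁ δ₂` (a `δ`-near-minimiser is a
`δᵢ`-near-minimiser by monotonicity of `E₀ + ·`). [folklore] -/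
theorem becDepletionSplit_nearMinCombine :
    ∀ (v : ℝ → ENNReal)
      (P Q R : (ρ : ℝ) → (N : ℕ) → Literature.MathematicalPhysics.QuantumManyBody.BoseGas.TrialState N (Literature.MathematicalPhysics.QuantumManyBody.BoseGas.sideLength ρ N) → Prop),
      (∀ ρ N Ψ, P ρ N Ψ → Q ρ N Ψ → R ρ N Ψ) →
      (∃ ρ₀ : ℝ, 0 < ρ₀ ∧ ∀ ρ : ℝ, 0 < ρ → ρ < ρ₀ → ∀ᶠ N : ℕ in Filter.atTop, ∃ δ : ENNReal, 0 < δ ∧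
        ∀ Ψ : Literature.MathematicalPhysics.QuantumManyBody.BoseGas.TrialState N (Literature.MathematicalPhysics.QuantumManyBody.BoseGas.sideLength ρ N),
          Literature.MathematicalPhysics.QuantumManyBody.BoseGas.energy v Ψ ≤
              Literature.MathematicalPhysics.QuantumManyBody.BoseGas.groundStateEnergy v N (Literature.MathematicalPhysics.QuantumManyBody.BoseGas.sideLength ρ N) + δ →
            P ρ N Ψ) →
      (∃ ρ₀ : ℝ, 0 < ρ₀ ∧ ∀ ρ : ℝ, 0 < ρ → ρ < ρ₀ → ∀ᶠ N : ℕ in Filter.atTop, ∃ δ : ENNReal, 0 < δ ∧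
        ∀ Ψ : Literature.MathematicalPhysics.QuantumManyBody.BoseGas.TrialState N (Literature.MathematicalPhysics.QuantumManyBody.BoseGas.sideLength ρ N),
          Literature.MathematicalPhysics.QuantumManyBody.BoseGas.energy v Ψ ≤
              Literature.MathematicalPhysics.QuantumManyBody.BoseGas.groundStateEnergy v N (Literature.MathematicalPhysics.QuantumManyBody.BoseGas.sideLength ρ N) + δ →
            Q ρ N Ψ) →
      ∃ ρ₀ : ℝ, 0 < ρ₀ ∧ ∀ ρ : ℝ, 0 < ρ → ρ < ρ₀ → ∀ᶠ N : ℕ in Filter.atTop, ∃ δ : ENNReal, 0 < δ ∧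
        ∀ Ψ : Literature.MathematicalPhysics.QuantumManyBody.BoseGas.TrialState N (Literature.MathematicalPhysics.QuantumManyBody.BoseGas.sideLength ρ N),
          Literature.MathematicalPhysics.QuantumManyBody.BoseGas.energy v Ψ ≤
              Literature.MathematicalPhysics.QuantumManyBody.BoseGas.groundStateEnergy v N (Literature.MathematicalPhysics.QuantumManyBody.BoseGas.sideLength ρ N) + δ →
            R ρ N Ψ := by
  intro v P Q R hPQR hP hQ
  obtain ⟨ρ₁, hρ₁, h1⟩ := hP
  obtain ⟨ρ₂, hρ₂, h2⟩ := hQ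
  refine ⟨min ρ₁ ρ₂, lt_min hρ₁ hρ₂, fun ρ hρ hρlt => ?_⟩
  filter_upwards [h1 ρ hρ (hρlt.trans_le (min_le_left _ _)),
    h2 ρ hρ (hρlt.trans_le (min_le_right _ _))] with N hN1 hN2
  obtain ⟨δ₁, hδ₁, hΨ1⟩ := hN1
  obtain ⟨δ₂, hδ₂, hΨ2⟩ := hN2
  refine ⟨min δ₁ δ₂, lt_min hδ₁ hδ₂, fun Ψ hΨ => hPQR ρ N Ψ (hΨ1 Ψ ?_) (hΨ2 Ψ ?_)⟩
  · exact hΨ.trans (add_le_add le_rfl (min_le_left _ _))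
  · exact hΨ.trans (add_le_add le_rfl (min_le_right _ _))

/-- **The crux `BecDepletionSplit` (stmt-AtomisticToContinuum-9026), by name.** Window count + ultraviolet
tail ⇒ inner-box depletion `≤ θ'N` with `θ' < 1`: `K, θ` from the tail hypothesis; `η, θ'` from
`becDepletionSplit_thresholdCombine`; window count at `(ε, K, η)`, tail at `ε`; the two near-minimiser
clauses combined by `becDepletionSplit_nearMinCombine`, the pointwise step being the lattice tsum split
(with `f k := ⟨φ'_k, γ_Ψ φ'_k⟩`, `R := K√ρ·L`) followed by the threshold arithmetic.
[cite: LSSY2005, Ch. 11 (11.26)–(11.27)] -/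
theorem BecDepletionSplit_proof :
    Summit.AtomisticToContinuum.BoseEinsteinCondensation.Theses.BECInfraredBound.BecDepletionSplit := by
  unfold Summit.AtomisticToContinuum.BoseEinsteinCondensation.Theses.BECInfraredBound.BecDepletionSplit
  intro v _hv hW hU
  obtain ⟨K, hK, θ, hθ, hUε⟩ := hU
  obtain ⟨η, hη, θ', hθ', hadd⟩ := becDepletionSplit_thresholdCombine θ hθ
  refine ⟨θ', hθ', fun ε hε hε' => ?_⟩
  refine becDepletionSplit_nearMinCombine v _ _ _ ?_ (hW ε hε hε' K hK η hη) (hUε ε hε hε')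
  intro ρ N Ψ hp hq
  refine le_trans ?_ (hadd N _ _ hp hq)
  exact becDepletionSplit_latticeTsumSplit
    (fun k : Fin 3 → ℤ => occupation N
      ({x : EuclideanSpace ℝ (Fin 3) |
          ∀ j, x j ∈ Set.Ioo (ε * sideLength ρ N) (sideLength ρ N - ε * sideLength ρ N)}.indicator
        fun x => ((Real.sqrt (((1 - 2 * ε) * sideLength ρ N) ^ 3))⁻¹ : ℂ) *
          Complex.exp (Complex.I * ↑(2 * Real.pi / ((1 - 2 * ε) * sideLength ρ N) *
            ∑ j, (k j : ℝ) * x j))) Ψ.ψ)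
    (K * Real.sqrt ρ * sideLength ρ N)

end Summit.AtomisticToContinuum.BoseEinsteinCondensation.Theorems

end
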